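import Summits.ABC.IUTFork.Cor312StatementGenuineM
import Summits.ABC.IUTFork.Cor312PilotIdelesMThetaSide
import HarnessLib

/-!
# [IUTchIII] Corollary 3.12 at the M-level genuine real setting, IN NUMBERS: `−|log(Θ)|` is a REAL number `θ` with
# `−deĝ_lgp(P_Θ) ≤ θ ≤ −|log Θ|_{genuine}`, `−|log(q)| = −|log q|_{genuine}`, and `Statement ↔ −|log q|_{genuine} ≤ θ` (G1-Θ endgame record)

PROOF-ONLY record file (D-0012; no definitions) of the abc-iut cell (seat abc-iut-w5-d244, gen 8; branch C «abc ⇐ S», C-lead ruling C-R12 (e)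
«target #2′: the M-level (V̲, K_{v̲}) real volume setting»). TAKES NO SIDE on [IUTchIII] Cor. 3.12.

[IUTchIII] Cor. 3.12 (kurims `paper:url-4b091feeb646` p. 174 l. 4–18) compares two procession-normalised log-volumes, `−|log(Θ)| ∈ ℝ ∪ {+∞}` and
`−|log(q)| ∈ ℝ`. At abc-iut-s2-p8's summand-route M-LEVEL GENUINE REAL SETTING `settingPrVolSharpM` of a Θ-volume input `I` OF the
initial Θ-data `D` ([IUTchI] Def. 3.1; carriers the completions `K_{v̲}`, `v̲ ∈ V̲`; pilot regions read off `I`'s OWN ideles `tOfIdeleData`,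
`tqM` — abc-iut-w5-d166 / abc-iut-w5-d033), the G1-Θ port PROVED every number-level fact; THIS FILE assembles them into the one sentence
the adjudication reads (`exists_real_negLogTheta_settingPrVolSharpM_genuine`): **there is a real number `θ` — the setting's `−|log(Θ)|` — with**
* `(settingPrVolSharpM …).negLogTheta = ↑θ` (`ThetaFinite` is a THEOREM: abc-iut-s2-p9 / abc-iut-s2-p8 `negLogTheta_settingPrVolSharpM_ne_top`,
  [IUTchIV] Thm. 1.10 Step (vi) off the bad primes; the Θ-side unit binder discharged by `norm_tOfIdeleData_eq_one_of_not_mem_image`);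
* `−deĝ_lgp,F_mod(P_Θ) ≤ θ` (abc-iut-s2-p9 `neg_ndegLgp_le_negLogTheta_settingPrVolM_tOfIdeleData`, Dupuy–Hilado Thm. 3.10.1 (ii): the sharp
  boxes lie in the hull, volumes are monotone);
* `θ ≤ I.negLogTheta` (abc-iut-s2-p8 `negLogTheta_settingPrVolSharpM_tOfIdeleData_le_genuine` ∘ abc-iut-w5-d166 ∘ abc-iut-s2-p7: the
  (Ind1)(Ind2)-orbit-hull bound, [IUTchIV] Thm. 1.10 Step (v), summand by summand against abc-iut-S2's `GenuineLogTheta`);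
* `(settingPrVolSharpM …).negLogQ = I.negAbsLogQ` (this seat, P5-numbers p440575: Dupuy–Hilado Thm. 3.10.1 (iii) over `F_mod`);
* `(settingPrVolSharpM …).Statement ↔ I.negAbsLogQ ≤ θ` (this seat's `statement_settingPrVolSharpM_iff_negAbsLogQ_le`, p442412).
So, at OUR genuine M-level instantiation, the typed Cor. 3.12 is ONE real inequality `I.negAbsLogQ ≤ θ` about a KERNEL-DEFINED hull volume `θ`
pinned in the interval `[−deĝ_lgp(P_Θ), I.negLogTheta]`; it implies Dupuy–Hilado's `I.Cor312Of` (`cor312Of_of_statement_settingPrVolSharpM`)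
and is implied by the indeterminacy-free inequality `I.negAbsLogQ ≤ −deĝ_lgp(P_Θ)` (`statement_settingPrVolSharpM_of_negAbsLogQ_le_neg_ndegLgp`,
recorded for completeness — NOT claimed to hold at honest data).

[cite: Mochizuki2012, IUTchIII Cor. 3.12 p. 174] [cite: Mochizuki2012, IUTchIV Thm. 1.10 p. 23, Steps (v)–(viii) p. 27–30]
[cite: DupuyHilado2025, §3.9, Thm. 3.10.1, §4.10] [claim: Mochizuki2012, status: disputed] for the quoted statement. HONEST FRAMING: statements
about OUR typed objects; nothing here asserts that `I.negAbsLogQ ≤ θ` holds or fails at any datum; no side taken on [IUTchIII] Cor. 3.12;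
typed ≠ proved; instantiated ≠ endorsed.
-/

noncomputable section

open Set Function NumberField IsDedekindDomain

namespace Summit.ABC.IUTFork.Thm311.Real

open Cor312 Cor312Vol Cor312Prov Literature.IUT.LogThetaLattice Literature.IUT.LogVolume Literature.IUT.HodgeTheaters
  Literature.NumberTheory.NumberFields

variable {F K Fbar : Type} [Field F] [NumberField F] [Field K] [NumberField K] [Algebra F K]
  [Field Fbar] [Algebra F Fbar] [Algebra K Fbar] {E : WeierstrassCurve F} [E.IsElliptic] {l : ℕ}
  {Pb : BadPlacePredicates K} (D : InitialThetaData F K Fbar E l Pb) {logvK : PadicLogsVal K}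
  (hlog : LogvAnalyticVal logvK) {I : ThetaVolumeInput (fieldOfModuli E) K} (hI : ThetaData.IsVolumeInputOf D I)
  (M : Type) [Field M] [NumberField M]
  (archPk : ∀ (j : (thetaIndexOfInitial D).Label) (vQ : (thetaIndexOfInitial D).VQ),
    Set ((logShellsOfInitialDH D logvK).Packet j vQ))
  (archSub : ∀ (j : (thetaIndexOfInitial D).Label) (v : (thetaIndexOfInitial D).V),
    Set ((logShellsOfInitialDH D logvK).Packet j ((thetaIndexOfInitial D).over v)))
  (Ψ : ℤ → ∀ v : (thetaIndexOfInitial D).V, v ∈ (thetaIndexOfInitial D).Vbad →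
    Set ((logShellsOfInitialDH D logvK).StarPacket v))
  (act : ℤ → ∀ v : (thetaIndexOfInitial D).V, v ∈ (thetaIndexOfInitial D).Vbad →
    (logShellsOfInitialDH D logvK).StarPacket v → Module.End ℚ ((logShellsOfInitialDH D logvK).StarPacket v))
  (Mmod : ℤ → ∀ j : (thetaIndexOfInitial D).LabelStar, Set ((logShellsOfInitialDH D logvK).GlobalPacket j.1))
  (region : ℤ → ∀ j : (thetaIndexOfInitial D).LabelStar, FinDivisor M → ∀ vQ : (thetaIndexOfInitial D).VQ,
    Set ((logShellsOfInitialDH D logvK).Packet j.1 vQ))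
  (n : ℤ) {HT : Type} {LogLink : HT → HT → Type} {IsFull : ∀ {s t : HT}, LogLink s t → Prop}
  (lat : LGPGaussianLogThetaLattice LogLink IsFull)
  {Frd : Type} {IsoF : Frd → Frd → Type} {Ob : Frd → Type} {realify : Frd → Frd} {Strip : Type}
  {IsoS : Strip → Strip → Type}
  {Mv : ∀ v : (thetaIndexOfInitial D).V, v ∈ (thetaIndexOfInitial D).Vbad → Type} [∀ v h, Monoid (Mv v h)]
  (sig : GlobalLGPFrobenioidSignature (thetaIndexOfInitial D).lstar (thetaIndexOfInitial D).V
    (· ∈ (thetaIndexOfInitial D).Vbad) Frd IsoF Ob realify Strip IsoS Mv)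
  (split : SplittingMonoids Mv) {ObΔ : Type}
  {N : ∀ v : (thetaIndexOfInitial D).V, v ∈ (thetaIndexOfInitial D).Vbad → Type} [∀ v h, Monoid (N v h)]
  (qData : QPilotData ObΔ N)
  (Sq : Finset (FinitePlace ℚ))
  (htq1 : ∀ (u : FinitePlace ℚ) (x : (thetaIndexOfInitial D).Fibre (Val.non u)), u ∉ Sq →
    ‖tqM D (ratChar u) u (natCast_ratChar_mem u) (ideleDataOf D hI) x‖ = 1)

/-- **`−|log(Θ)| ≠ +∞` at the genuine setting — NO hypothesis** (abc-iut-s2-p8 `negLogTheta_settingPrVolSharpM_ne_top`, its Θ-idele binders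
discharged: `tOfIdeleData_ne_zero`, and units off the places of `ℚ` under the bad primes, abc-iut-s2-p9 `norm_tOfIdeleData_eq_one_of_not_mem_image`).
[cite: Mochizuki2012, IUTchIII Cor. 3.12 p. 174] -/
theorem negLogTheta_settingPrVolSharpM_genuine_ne_top :
    (settingPrVolSharpM D hlog (tOfIdeleData D (ideleDataOf D hI))
        (fun u x => tqM D (ratChar u) u (natCast_ratChar_mem u) (ideleDataOf D hI) x) M archPk archSub Ψ act Mmod region n lat sig split
        qData (fun u x => tqM_ne_zero D (ratChar u) u (natCast_ratChar_mem u) (ideleDataOf D hI) x) Sq htq1).negLogTheta ≠ ⊤ := by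
  classical
  exact negLogTheta_settingPrVolSharpM_ne_top D hlog (tOfIdeleData D (ideleDataOf D hI))
    (fun u x => tqM D (ratChar u) u (natCast_ratChar_mem u) (ideleDataOf D hI) x) M archPk archSub Ψ act Mmod region n lat sig split qData
    (fun u x => tqM_ne_zero D (ratChar u) u (natCast_ratChar_mem u) (ideleDataOf D hI) x) Sq htq1
    (tOfIdeleData_ne_zero D (ideleDataOf D hI))
    ((ThetaData.pilotData D).S.image fun v =>
      placeOfPrimeQ (residueChar (fieldOfModuli E) v) (residueChar_prime (fieldOfModuli E) v))
    (fun u i x hu => norm_tOfIdeleData_eq_one_of_not_mem_image D (ideleDataOf D hI) u i x hu)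

/-- **The typed Cor. 3.12 at the genuine setting is ONE inequality**: `Statement ↔ ↑I.negAbsLogQ ≤ −|log(Θ)|` (the `≠ ⊤` conjunct is a
theorem, the `q`-side is abc-iut-S2's number). [cite: Mochizuki2012, IUTchIII Cor. 3.12 p. 174] -/
theorem statement_settingPrVolSharpM_genuine_iff_le :
    (settingPrVolSharpM D hlog (tOfIdeleData D (ideleDataOf D hI))
        (fun u x => tqM D (ratChar u) u (natCast_ratChar_mem u) (ideleDataOf D hI) x) M archPk archSub Ψ act Mmod region n lat sig split
        qData (fun u x => tqM_ne_zero D (ratChar u) u (natCast_ratChar_mem u) (ideleDataOf D hI) x) Sq htq1).Statement ↔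
      ((I.negAbsLogQ : ℝ) : WithTop ℝ) ≤
        (settingPrVolSharpM D hlog (tOfIdeleData D (ideleDataOf D hI))
          (fun u x => tqM D (ratChar u) u (natCast_ratChar_mem u) (ideleDataOf D hI) x) M archPk archSub Ψ act Mmod region n lat sig split
          qData (fun u x => tqM_ne_zero D (ratChar u) u (natCast_ratChar_mem u) (ideleDataOf D hI) x) Sq htq1).negLogTheta := by
  rw [statement_settingPrVolSharpM_iff_negAbsLogQ_le]
  exact ⟨fun h => h.2, fun h => ⟨negLogTheta_settingPrVolSharpM_genuine_ne_top D hlog hI M archPk archSub Ψ act Mmod region n lat sig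
    split qData Sq htq1, h⟩⟩

/-- **Lower bound at the genuine setting**: `−deĝ_lgp,F_mod(P_Θ) ≤ −|log(Θ)|` (abc-iut-s2-p9's
`neg_ndegLgp_le_negLogTheta_settingPrVolM_tOfIdeleData`, read at abc-iut-s2-p8's `settingPrVolSharpM` = `settingPrVolM` at the sharp binders).
[cite: DupuyHilado2025, Thm. 3.10.1] -/
theorem neg_ndegLgp_le_negLogTheta_settingPrVolSharpM_genuine :
    (((-LgpDivisor.ndegLgp (ThetaData.volumeInputOf D (ideleDataOf D hI)).X.thetaPilot : ℝ)) : WithTop ℝ) ≤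
      (settingPrVolSharpM D hlog (tOfIdeleData D (ideleDataOf D hI))
        (fun u x => tqM D (ratChar u) u (natCast_ratChar_mem u) (ideleDataOf D hI) x) M archPk archSub Ψ act Mmod region n lat sig split
        qData (fun u x => tqM_ne_zero D (ratChar u) u (natCast_ratChar_mem u) (ideleDataOf D hI) x) Sq htq1).negLogTheta :=
  neg_ndegLgp_le_negLogTheta_settingPrVolM_tOfIdeleData D hlog (ideleDataOf D hI) M archPk archSub Ψ act Mmod region n lat sig split qData
    (fun u x => tqM D (ratChar u) u (natCast_ratChar_mem u) (ideleDataOf D hI) x)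
    (fun u x => tqM_ne_zero D (ratChar u) u (natCast_ratChar_mem u) (ideleDataOf D hI) x)
    (qSupport_finite_PrVolM_sharp D hlog M archPk archSub Ψ act Mmod region n qData
      (fun u x => tqM D (ratChar u) u (natCast_ratChar_mem u) (ideleDataOf D hI) x)
      (fun u x => tqM_ne_zero D (ratChar u) u (natCast_ratChar_mem u) (ideleDataOf D hI) x) Sq htq1)

/-- **Upper bound at the genuine setting**: `−|log(Θ)| ≤ ↑I.negLogTheta` (abc-iut-s2-p8 `negLogTheta_settingPrVolSharpM_tOfIdeleData_le_genuine`
at `r := ideleDataOf D hI`, abc-iut-w5-d033 `negLogTheta_eq_ideleDataOf`). [cite: Mochizuki2012, IUTchIII Cor. 3.12 p. 173–174] -/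
theorem negLogTheta_settingPrVolSharpM_genuine_le :
    (settingPrVolSharpM D hlog (tOfIdeleData D (ideleDataOf D hI))
        (fun u x => tqM D (ratChar u) u (natCast_ratChar_mem u) (ideleDataOf D hI) x) M archPk archSub Ψ act Mmod region n lat sig split
        qData (fun u x => tqM_ne_zero D (ratChar u) u (natCast_ratChar_mem u) (ideleDataOf D hI) x) Sq htq1).negLogTheta ≤ ((I.negLogTheta : ℝ) : WithTop ℝ) := by
  have h := negLogTheta_settingPrVolSharpM_tOfIdeleData_le_genuine D hlog (ideleDataOf D hI)
    (fun u x => tqM D (ratChar u) u (natCast_ratChar_mem u) (ideleDataOf D hI) x) M archPk archSub Ψ act Mmod region n lat sig split qData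
    (fun u x => tqM_ne_zero D (ratChar u) u (natCast_ratChar_mem u) (ideleDataOf D hI) x) Sq htq1
  rwa [← negLogTheta_eq_ideleDataOf D hI] at h

/-- **`−|log(Θ)|` OF THE GENUINE SETTING, IN NUMBERS**: there is a real `θ` with `negLogTheta = ↑θ`, `−deĝ_lgp,F_mod(P_Θ) ≤ θ ≤ I.negLogTheta`,
`negLogQ = I.negAbsLogQ`, and `Statement ↔ I.negAbsLogQ ≤ θ` — the adjudication's one-line numeric form of [IUTchIII] Cor. 3.12 at OUR
M-level genuine instantiation (lower bound abc-iut-s2-p9, upper bound abc-iut-s2-p8 ∘ abc-iut-w5-d166 ∘ abc-iut-s2-p7, `q`-side this seat).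
[cite: Mochizuki2012, IUTchIII Cor. 3.12 p. 174] [cite: DupuyHilado2025, Thm. 3.10.1, §4.10] -/
theorem exists_real_negLogTheta_settingPrVolSharpM_genuine :
    ∃ θ : ℝ,
      (settingPrVolSharpM D hlog (tOfIdeleData D (ideleDataOf D hI))
          (fun u x => tqM D (ratChar u) u (natCast_ratChar_mem u) (ideleDataOf D hI) x) M archPk archSub Ψ act Mmod region n lat sig split
          qData (fun u x => tqM_ne_zero D (ratChar u) u (natCast_ratChar_mem u) (ideleDataOf D hI) x) Sq htq1).negLogTheta = (θ : WithTop ℝ) ∧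
      -LgpDivisor.ndegLgp (ThetaData.pilotData D).thetaPilot ≤ θ ∧
      θ ≤ I.negLogTheta ∧
      (settingPrVolSharpM D hlog (tOfIdeleData D (ideleDataOf D hI))
          (fun u x => tqM D (ratChar u) u (natCast_ratChar_mem u) (ideleDataOf D hI) x) M archPk archSub Ψ act Mmod region n lat sig split
          qData (fun u x => tqM_ne_zero D (ratChar u) u (natCast_ratChar_mem u) (ideleDataOf D hI) x) Sq htq1).negLogQ = I.negAbsLogQ ∧
      ((settingPrVolSharpM D hlog (tOfIdeleData D (ideleDataOf D hI))
          (fun u x => tqM D (ratChar u) u (natCast_ratChar_mem u) (ideleDataOf D hI) x) M archPk archSub Ψ act Mmod region n lat sig split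
          qData (fun u x => tqM_ne_zero D (ratChar u) u (natCast_ratChar_mem u) (ideleDataOf D hI) x) Sq htq1).Statement ↔
        I.negAbsLogQ ≤ θ) := by
  obtain ⟨θ, hθ⟩ := WithTop.ne_top_iff_exists.mp (negLogTheta_settingPrVolSharpM_genuine_ne_top D hlog hI M archPk archSub Ψ act Mmod
    region n lat sig split qData Sq htq1)
  refine ⟨θ, hθ.symm, ?_, ?_, ?_, ?_⟩
  · have h := neg_ndegLgp_le_negLogTheta_settingPrVolSharpM_genuine D hlog hI M archPk archSub Ψ act Mmod region n lat sig split qData Sq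
      htq1
    rw [← hθ] at h
    exact WithTop.coe_le_coe.mp h
  · have h := negLogTheta_settingPrVolSharpM_genuine_le D hlog hI M archPk archSub Ψ act Mmod region n lat sig split qData Sq htq1
    rw [← hθ] at h
    exact WithTop.coe_le_coe.mp h
  · exact negLogQ_settingPrVolSharpM_ideleDataOf_eq_negAbsLogQ D hlog M archPk archSub Ψ act Mmod region n lat sig split qData
      (tOfIdeleData D (ideleDataOf D hI)) Sq hI htq1
  · rw [statement_settingPrVolSharpM_genuine_iff_le, ← hθ, WithTop.coe_le_coe]

/-- For completeness: the INDETERMINACY-FREE inequality `I.negAbsLogQ ≤ −deĝ_lgp,F_mod(P_Θ)` (the `q`-volume below the Θ-pilot DEGREE, no hull)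
would imply the typed Cor. 3.12 at the genuine setting. NOT claimed to hold at any datum (at honest data the Θ-pilot degree exceeds the
`q`-pilot degree); recorded only to bracket the adjudication inequality. [cite: DupuyHilado2025, Thm. 3.10.1] -/
theorem statement_settingPrVolSharpM_of_negAbsLogQ_le_neg_ndegLgp
    (h : I.negAbsLogQ ≤ -LgpDivisor.ndegLgp (ThetaData.pilotData D).thetaPilot) :
    (settingPrVolSharpM D hlog (tOfIdeleData D (ideleDataOf D hI))
        (fun u x => tqM D (ratChar u) u (natCast_ratChar_mem u) (ideleDataOf D hI) x) M archPk archSub Ψ act Mmod region n lat sig split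
        qData (fun u x => tqM_ne_zero D (ratChar u) u (natCast_ratChar_mem u) (ideleDataOf D hI) x) Sq htq1).Statement := by
  obtain ⟨θ, -, hlow, -, -, hiff⟩ := exists_real_negLogTheta_settingPrVolSharpM_genuine D hlog hI M archPk archSub Ψ act Mmod region n
    lat sig split qData Sq htq1
  exact hiff.mpr (h.trans hlow)

end Summit.ABC.IUTFork.Thm311.Real

end
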